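import Mathlib

/-!
# SEIL-F outer end: the polar inner problem — exact Gaussian-moment closure (solo-blind s87, kernel #195)

LEMMA R of the outer theorem (PLAN §107–§109) needs an explicit leading-order loop kernel
whose weighted Schur norm can be bounded by hand.  The one-generation WKB–Kelvin kernel (D71)
captures only ≈ 30 % of the Schur mass (A338): the missing mass is the ROLL read-out of
low-mode POLAR streak content (D74), i.e. content near the stationary points `θ = 0, π` of the
Doppler multiplier `2 P h(t) cos θ`, where the Kelvin shear vanishes and the amplitude diffusion
`K₀ ∂²_θ` (dropped by WKB) is of the same order as the dephasing.  Near a pole,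
`2 P h cos θ = 2 P h - P h θ² + O(θ⁴)`; after removing the fast phase `exp(2 i P ∫ h)` the
streak equation is, to leading order, the complex harmonic-oscillator heat equation

  `∂_t S = K₀ ∂²_θ S - i κ(t) θ² S`,   `κ(t) = P h(t)`  (time dependent),

with initial data of the form `(B₀ + C₀ θ²)` (the frame near the pole is `≈ -(hₓ/h) θ²` plus an
offset).  This equation has an EXACT finite-dimensional solution family — the polar inner
parametrix used by D78 / LEMMA R:

  `S(t, θ) = (B(t) + C(t) θ²) · exp(-a(t) θ²)`  solves it  iff
  `a' = i κ - 4 K₀ a²` (Riccati),  `C' = -10 K₀ a C`,  `B' = -2 K₀ a B + 2 K₀ C`.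

No frozen-coefficient assumption is involved (`κ` is an arbitrary function of `t`).  For frozen
`κ > 0` the Riccati fixed point is `a⋆ = e^{iπ/4} (κ / 4K₀)^{1/2}`: the cap localises on the
width `(Re a⋆)^{-1/2} = (8 K₀ / κ)^{1/4}` and the amplitude `B` decays at the rate
`Re (2 K₀ a⋆) = (K₀ κ / 2)^{1/2}` — the polar lifetime `(2 K₀ P h)^{-1/2}·√… ` measured in
D74/D75 (SB-C1079).

This file certifies: (i) the `θ`-derivatives of `q(θ) e^{-a θ²}` (first and second, over `ℂ`,
hence for real `θ` by restriction); (ii) the time-derivative identity: under the three ODEs the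
ansatz satisfies the PDE pointwise, for every `θ : ℂ`; (iii) the fixed point `a⋆` of the frozen
Riccati equation, its defining identity `4 K₀ a⋆² = i κ`, and the two real numbers
`Re a⋆ = √(κ / 8K₀)`, `Re (2 K₀ a⋆) = √(K₀ κ / 2)`.
-/

namespace Summit.AnomalousDissipation.AnomalousDissipation.Theorems

open Complex

/-- Product rule against the Gaussian: if `q` has derivative `q'` at `z` then
`w ↦ q(w) e^{-α w²}` has derivative `(q' - 2 α z q(z)) e^{-α z²}` at `z`. -/
theorem polarGaussian_hasDerivAt_mul {q : ℂ → ℂ} {q' : ℂ} (α z : ℂ) (hq : HasDerivAt q q' z) :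
    HasDerivAt (fun w => q w * cexp (-(α * w ^ 2)))
      ((q' - 2 * α * z * q z) * cexp (-(α * z ^ 2))) z := by
  have hin : HasDerivAt (fun w : ℂ => -(α * w ^ 2)) (-(α * (2 * z))) z := by
    have h := ((hasDerivAt_pow 2 z).const_mul α).neg
    exact h.congr_deriv (by simp)
  have hexp : HasDerivAt (fun w : ℂ => cexp (-(α * w ^ 2)))
      (cexp (-(α * z ^ 2)) * (-(α * (2 * z)))) z := hin.cexp
  have h := hq.mul hexp
  exact h.congr_deriv (by ring)

/-- First `θ`-derivative of the polar ansatz `(β + γ θ²) e^{-α θ²}`. -/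
theorem polarGaussian_hasDerivAt_θ (α β γ z : ℂ) :
    HasDerivAt (fun w => (β + γ * w ^ 2) * cexp (-(α * w ^ 2)))
      ((2 * γ * z - 2 * α * z * (β + γ * z ^ 2)) * cexp (-(α * z ^ 2))) z := by
  have hq : HasDerivAt (fun w : ℂ => β + γ * w ^ 2) (γ * (2 * z)) z := by
    have h := ((hasDerivAt_pow 2 z).const_mul γ).const_add β
    exact h.congr_deriv (by simp)
  have h := polarGaussian_hasDerivAt_mul α z hq
  exact h.congr_deriv (by ring)

/-- Second `θ`-derivative of the polar ansatz: the derivative of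
`(2 γ θ - 2 α θ (β + γ θ²)) e^{-α θ²}` is `((2γ - 2αβ) + (4α²β - 10αγ) θ² + 4α²γ θ⁴) e^{-α θ²}`. -/
theorem polarGaussian_hasDerivAt_θθ (α β γ z : ℂ) :
    HasDerivAt (fun w => (2 * γ * w - 2 * α * w * (β + γ * w ^ 2)) * cexp (-(α * w ^ 2)))
      (((2 * γ - 2 * α * β) + (4 * α ^ 2 * β - 10 * α * γ) * z ^ 2 + 4 * α ^ 2 * γ * z ^ 4)
        * cexp (-(α * z ^ 2))) z := by
  have hq : HasDerivAt (fun w : ℂ => 2 * γ * w - 2 * α * w * (β + γ * w ^ 2))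
      (2 * γ - (2 * α * (β + γ * z ^ 2) + 2 * α * z * (γ * (2 * z)))) z := by
    have h1 : HasDerivAt (fun w : ℂ => 2 * γ * w) (2 * γ) z := by
      simpa using (hasDerivAt_id z).const_mul (2 * γ)
    have h2 : HasDerivAt (fun w : ℂ => 2 * α * w) (2 * α) z := by
      simpa using (hasDerivAt_id z).const_mul (2 * α)
    have h3 : HasDerivAt (fun w : ℂ => β + γ * w ^ 2) (γ * (2 * z)) z := by
      have h := ((hasDerivAt_pow 2 z).const_mul γ).const_add β
      exact h.congr_deriv (by simp)
    have h := h1.sub (h2.mul h3)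
    exact h.congr_deriv (by simp)
  have h := polarGaussian_hasDerivAt_mul α z hq
  exact h.congr_deriv (by ring)

/-- The same two derivatives for REAL `θ` (restriction of the complex ones). -/
theorem polarGaussian_hasDerivAt_θ_real (α β γ : ℂ) (θ : ℝ) :
    HasDerivAt (fun x : ℝ => (β + γ * (x : ℂ) ^ 2) * cexp (-(α * (x : ℂ) ^ 2)))
      ((2 * γ * θ - 2 * α * θ * (β + γ * (θ : ℂ) ^ 2)) * cexp (-(α * (θ : ℂ) ^ 2))) θ :=
  (polarGaussian_hasDerivAt_θ α β γ θ).comp_ofReal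

/-- Second `θ`-derivative for real `θ` (restriction of `polarGaussian_hasDerivAt_θθ`). -/
theorem polarGaussian_hasDerivAt_θθ_real (α β γ : ℂ) (θ : ℝ) :
    HasDerivAt (fun x : ℝ => (2 * γ * (x : ℂ) - 2 * α * (x : ℂ) * (β + γ * (x : ℂ) ^ 2))
        * cexp (-(α * (x : ℂ) ^ 2)))
      (((2 * γ - 2 * α * β) + (4 * α ^ 2 * β - 10 * α * γ) * (θ : ℂ) ^ 2
          + 4 * α ^ 2 * γ * (θ : ℂ) ^ 4) * cexp (-(α * (θ : ℂ) ^ 2))) θ :=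
  (polarGaussian_hasDerivAt_θθ α β γ θ).comp_ofReal

/-- The polar ansatz as a function of time `t` and (complex) angle variable `θ`. -/
noncomputable def polarAnsatz (a B C : ℝ → ℂ) (t : ℝ) (θ : ℂ) : ℂ :=
  (B t + C t * θ ^ 2) * cexp (-(a t * θ ^ 2))

/-- Its second `θ`-derivative in closed form (certified by `polarGaussian_hasDerivAt_θθ`). -/
noncomputable def polarAnsatz_θθ (a B C : ℝ → ℂ) (t : ℝ) (θ : ℂ) : ℂ :=
  ((2 * C t - 2 * a t * B t) + (4 * a t ^ 2 * B t - 10 * a t * C t) * θ ^ 2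
      + 4 * a t ^ 2 * C t * θ ^ 4) * cexp (-(a t * θ ^ 2))

/-- Time derivative of the ansatz (product/chain rule in `t`, `θ` fixed). -/
theorem polarAnsatz_hasDerivAt_t {a B C : ℝ → ℂ} {a' B' C' : ℂ} {t : ℝ} (θ : ℂ)
    (ha : HasDerivAt a a' t) (hB : HasDerivAt B B' t) (hC : HasDerivAt C C' t) :
    HasDerivAt (fun τ => polarAnsatz a B C τ θ)
      ((B' + C' * θ ^ 2 - a' * θ ^ 2 * (B t + C t * θ ^ 2)) * cexp (-(a t * θ ^ 2))) t := by
  unfold polarAnsatz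
  have hq : HasDerivAt (fun τ => B τ + C τ * θ ^ 2) (B' + C' * θ ^ 2) t :=
    hB.add (hC.mul_const (θ ^ 2))
  have hin : HasDerivAt (fun τ => -(a τ * θ ^ 2)) (-(a' * θ ^ 2)) t := (ha.mul_const (θ ^ 2)).neg
  have hexp : HasDerivAt (fun τ => cexp (-(a τ * θ ^ 2)))
      (cexp (-(a t * θ ^ 2)) * (-(a' * θ ^ 2))) t := hin.cexp
  have h := hq.mul hexp
  exact h.congr_deriv (by ring)

/-- MAIN IDENTITY (exact polar inner solution).  If `a, B, C` satisfy the Gaussian-moment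
system `a' = iκ - 4K₀a²`, `C' = -10K₀ a C`, `B' = -2K₀ a B + 2K₀ C` at time `t`, then the
ansatz `S = (B + C θ²) e^{-a θ²}` satisfies `∂_t S = K₀ ∂²_θ S - i κ θ² S` at `(t, θ)` for every
`θ : ℂ` (in particular every real `θ`).  `κ` and `K₀` are the instantaneous values: no
frozen-coefficient assumption. -/
theorem polarAnsatz_solves {a B C : ℝ → ℂ} {t : ℝ} (K₀ κ : ℂ) (θ : ℂ)
    (ha : HasDerivAt a (I * κ - 4 * K₀ * a t ^ 2) t)
    (hC : HasDerivAt C (-10 * K₀ * a t * C t) t)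
    (hB : HasDerivAt B (-2 * K₀ * a t * B t + 2 * K₀ * C t) t) :
    HasDerivAt (fun τ => polarAnsatz a B C τ θ)
      (K₀ * polarAnsatz_θθ a B C t θ - I * κ * θ ^ 2 * polarAnsatz a B C t θ) t := by
  have h := polarAnsatz_hasDerivAt_t θ ha hB hC
  refine h.congr_deriv ?_
  unfold polarAnsatz polarAnsatz_θθ
  ring

/-- Consistency: `polarAnsatz_θθ` IS the second `θ`-derivative of `polarAnsatz` (complex
variable), via the first derivative `(2Cθ - 2aθ(B + Cθ²)) e^{-aθ²}`. -/
theorem polarAnsatz_θ_deriv (a B C : ℝ → ℂ) (t : ℝ) (z : ℂ) :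
    HasDerivAt (fun w => polarAnsatz a B C t w)
      ((2 * C t * z - 2 * a t * z * (B t + C t * z ^ 2)) * cexp (-(a t * z ^ 2))) z :=
  polarGaussian_hasDerivAt_θ (a t) (B t) (C t) z

/-- … and `polarAnsatz_θθ` is the derivative of that first derivative. -/
theorem polarAnsatz_θθ_deriv (a B C : ℝ → ℂ) (t : ℝ) (z : ℂ) :
    HasDerivAt (fun w => (2 * C t * w - 2 * a t * w * (B t + C t * w ^ 2)) * cexp (-(a t * w ^ 2)))
      (polarAnsatz_θθ a B C t z) z :=
  polarGaussian_hasDerivAt_θθ (a t) (B t) (C t) z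

/-! ### The frozen Riccati fixed point `a⋆ = e^{iπ/4} √(κ / 4K₀)` -/

/-- The fixed point of `a' = iκ - 4K₀a²` for frozen `κ ≥ 0`, `K₀ > 0`, written as
`a⋆ = (1 + i) · √(κ/(8K₀))` (`= e^{iπ/4} √(κ/(4K₀))`). -/
noncomputable def polarFixedPoint (K₀ κ : ℝ) : ℂ :=
  (1 + I) * (Real.sqrt (κ / (8 * K₀)) : ℂ)

/-- `a⋆² = i κ / (4K₀)`. -/
theorem polarFixedPoint_sq (K₀ κ : ℝ) (hK : 0 < K₀) (hκ : 0 ≤ κ) :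
    polarFixedPoint K₀ κ ^ 2 = I * (κ / (4 * K₀) : ℝ) := by
  unfold polarFixedPoint
  have hs : ((Real.sqrt (κ / (8 * K₀)) : ℂ)) ^ 2 = ((κ / (8 * K₀) : ℝ) : ℂ) := by
    rw [← ofReal_pow, Real.sq_sqrt (by positivity)]
  have hI : (1 + I) ^ 2 = 2 * I := by
    rw [add_sq, I_sq]; ring
  rw [mul_pow, hs, hI]
  have hK' : (K₀ : ℂ) ≠ 0 := by exact_mod_cast hK.ne'
  push_cast
  field_simp
  ring

/-- `a⋆` is a fixed point: `iκ - 4K₀ a⋆² = 0`. -/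
theorem polarFixedPoint_riccati (K₀ κ : ℝ) (hK : 0 < K₀) (hκ : 0 ≤ κ) :
    I * κ - 4 * K₀ * polarFixedPoint K₀ κ ^ 2 = 0 := by
  rw [polarFixedPoint_sq K₀ κ hK hκ]
  have hK' : (K₀ : ℂ) ≠ 0 := by exact_mod_cast hK.ne'
  push_cast
  field_simp
  ring

/-- Localisation width: `Re a⋆ = √(κ / (8K₀))` (so `|e^{-a⋆θ²}| = e^{-θ²√(κ/8K₀)}`: cap width
`(8K₀/κ)^{1/4}`); also `Im a⋆ = Re a⋆`. -/
theorem polarFixedPoint_re (K₀ κ : ℝ) :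
    (polarFixedPoint K₀ κ).re = Real.sqrt (κ / (8 * K₀)) := by
  unfold polarFixedPoint
  simp [mul_re]

/-- `Im a⋆ = √(κ/(8K₀))` (`= Re a⋆`: the argument of `a⋆` is `π/4`). -/
theorem polarFixedPoint_im (K₀ κ : ℝ) :
    (polarFixedPoint K₀ κ).im = Real.sqrt (κ / (8 * K₀)) := by
  unfold polarFixedPoint
  simp [mul_im]

/-- Decay rate of the cap amplitude: `Re (2K₀ a⋆) = √(K₀ κ / 2)` (the polar lifetime is its
inverse). -/
theorem polarFixedPoint_rate (K₀ κ : ℝ) (hK : 0 < K₀) :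
    (2 * K₀ * polarFixedPoint K₀ κ).re = Real.sqrt (K₀ * κ / 2) := by
  have h1 : (2 * K₀ * polarFixedPoint K₀ κ).re = 2 * K₀ * (polarFixedPoint K₀ κ).re := by
    have : (2 * (K₀ : ℂ) * polarFixedPoint K₀ κ) = ((2 * K₀ : ℝ) : ℂ) * polarFixedPoint K₀ κ := by
      push_cast; ring
    rw [this, re_ofReal_mul]
  rw [h1, polarFixedPoint_re K₀ κ]
  have h2K : (2 * K₀ : ℝ) = Real.sqrt ((2 * K₀) ^ 2) := by
    rw [Real.sqrt_sq (by positivity)]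
  rw [h2K, ← Real.sqrt_mul (by positivity)]
  congr 1
  field_simp
  ring

end Summit.AnomalousDissipation.AnomalousDissipation.Theorems
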